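import Summits.HodgeConjecture.HodgeConjecture.Theorems.Ring2AbelianAllWeilCellsWrongSign
import Summits.HodgeConjecture.HodgeConjecture.Theorems.Ring2AbelianAllLandherr
import HarnessLib

/-!
# Ring 2 · AbelianAll (ab-weil-1, gen 8, part 6) — the Weil floor RE-BASED on ab-weil-2's Landherr theorem:
  the binder `(hL : LandherrSplitCriterion)` is discharged by `landherrSplitCriterion_holds`

research route, not a corollary; conditional on HC_CM plus one named minimal statement.
Cell line: research route conditional on HC_CM; not a corollary; Q11.4-sentence-2 already refuted in dim ≥ 3.
`HC_CM` (`Theses.RankFourFaces.CMAbelianHodge`) does not occur in this file; no open case of the Hodge conjecture is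
claimed; no definition, no named fact.

Seat ab-weil-2 (gen 3, `Ring2AbelianAllLandherr`) made the cell's typed print obligation
`Ring2.Hypotheses.LandherrSplitCriterion` ("`(A, φ)` is hyperbolic for `h_K` iff `det H = [(-1)ⁿ]`", van Geemen
LNM 1594 (5.4.1) after Landherr 1936) a THEOREM of the tree, `landherrSplitCriterion_holds` (abstract Landherr for
van Geemen's Hermitian form via Meyer's theorem, then on the carriers). This file applies that ONE TERM to the rows of
this seat that carried `(hL : LandherrSplitCriterion)` (append-only: new names with suffix `_L`, old rows kept):

* `weilClassesComponent_two_of_refereed_and_residualSq_L`, `markmanFourfolds_of_refereed_and_positive_residualSq_L`;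
* the dim `≤ 5` FLOOR `hodgeConjectureFor_abelian_dim_le_five_of_refereed_and_positive_residualSq_L`, whose print
  inputs are now exactly FOUR refereed facts — Moonen–Zarhin 1999 (reduction of dim `≤ 5` to Weil fourfolds), Koike
  2004 (`(3, 1, [-1])`), Schoen 1998/2007 (`(3, 3, [-1])`), Markman 2023 (`(2, d, [1])`, generalized Kummers) — plus
  the ONE open family: the positive non-split squarefree fourfold cells `WeilClassesComponent 2 d₀ δ`
  (`d₀ ∉ {1, 3}` squarefree, `δ ≠ [1]`, `sign δ = +1`);
* the same floor fed by the gen-8 residual pair `IsogenyConnectedWeilComponent 2 d₀ δ ∧ WeilVariationalHodgeComponent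
  2 d₀ δ` (part 4), on the signed cells (`…_connected_variational_L`) or uniformly (`…_connected_variational_L'`, the
  negative cells being theorems by part 5).

## References
* W. Landherr, Abh. Math. Sem. Hamburg 11 (1936) — via van Geemen LNM 1594 (5.4.1). [vanGeemen1994HodgeAV]
* B. J. J. Moonen, Yu. G. Zarhin, Duke Math. J. 77 (1995) / Compositio 1999, Thm. 0.1. [MoonenZarhin1999]
* K. Koike, *Algebraicity of some Weil Hodge classes*, Canad. Math. Bull. 47 (2004). [Koike2004WeilHodge]
* C. Schoen, Compositio Math. 65 (1988); addendum 114 (1998). [Schoen1988HodgeWeil] [Schoen1998HodgeWeilAddendum]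
* E. Markman, JEMS 25 (2023), Thm. 1.5. [Markman2023GeneralizedKummers]
-/

noncomputable section

set_option linter.dupNamespace false

open CategoryTheory
open Literature.AlgebraicGeometry Literature.AlgebraicGeometry.Motives
open Literature.AlgebraicGeometry.HodgeTheory
open Literature.AlgebraicGeometry.VanGeemen1994
open Summit.HodgeConjecture.HodgeConjecture.Ring2.Hypotheses

namespace Summit.HodgeConjecture.HodgeConjecture.Ring2.AbelianAll

/-- **Every squarefree fourfold δ-cell from three refereed facts + the squarefree residual** (Landherr discharged).
[cite: vanGeemen1994HodgeAV, (5.4.1) and Thm. 6.12] [cite: Markman2023GeneralizedKummers, Thm. 1.5] -/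
theorem weilClassesComponent_two_of_refereed_and_residualSq_L
    (hK : Koike2004_weilClasses_algebraic_hyperbolicSixfold_one)
    (hS : Schoen1998_weilClasses_algebraic_hyperbolicSixfold_three)
    (hM23 : Markman2023_weilClasses_algebraic_discOneWeilFourfold)
    (hR : WeilFourfoldResidualSq) {d : ℕ} (hd : 0 < d) (hsq : Squarefree d)
    (δ : weilNormResidueGroup d) : WeilClassesComponent 2 d δ :=
  weilClassesComponent_two_of_refereed_and_residualSq hK hS landherrSplitCriterion_holds hM23 hR hd hsq δ

/-- **Markman's fourfold statement from three refereed facts + the POSITIVE squarefree residual** (Landherr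
discharged). [cite: Markman2025SurveySecant, Thm. 1.2 (statement only; preprint)] [cite: vanGeemen1994HodgeAV, (5.4.1), Lemma 5.2 (4)] -/
theorem markmanFourfolds_of_refereed_and_positive_residualSq_L
    (hK : Koike2004_weilClasses_algebraic_hyperbolicSixfold_one)
    (hS : Schoen1998_weilClasses_algebraic_hyperbolicSixfold_three)
    (hM23 : Markman2023_weilClasses_algebraic_discOneWeilFourfold)
    (hR : ∀ d : ℕ, 0 < d → Squarefree d → d ≠ 1 → d ≠ 3 → ∀ δ : weilNormResidueGroup d,
      δ ≠ splitDiscriminantClass 2 d → weilSign d δ = 1 → WeilClassesComponent 2 d δ) :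
    Markman2025_weilClasses_algebraic_abelianFourfold :=
  markmanFourfolds_of_refereed_and_positive_residualSq hK hS landherrSplitCriterion_holds hM23 hR

/-- **THE FLOOR, re-based.** `HC` for every complex abelian variety of dimension `≤ 5` from FOUR refereed print facts
(Moonen–Zarhin 1999, Koike 2004, Schoen 1998, Markman 2023) and the ONE open family of positive non-split squarefree
fourfold cells — Landherr's criterion is no longer a binder (ab-weil-2, `landherrSplitCriterion_holds`).
[cite: MoonenZarhin1999, Thm. 0.1] [cite: Markman2023GeneralizedKummers, Thm. 1.5] [cite: vanGeemen1994HodgeAV, (5.4.1), Lemma 5.2 (4), Thm. 6.12] -/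
theorem hodgeConjectureFor_abelian_dim_le_five_of_refereed_and_positive_residualSq_L
    (hred : MoonenZarhin1999_hodgeClasses_abelian_dim_le_five_of_weilClassesFourfolds)
    (hK : Koike2004_weilClasses_algebraic_hyperbolicSixfold_one)
    (hS : Schoen1998_weilClasses_algebraic_hyperbolicSixfold_three)
    (hM23 : Markman2023_weilClasses_algebraic_discOneWeilFourfold)
    (hR : ∀ d : ℕ, 0 < d → Squarefree d → d ≠ 1 → d ≠ 3 → ∀ δ : weilNormResidueGroup d,
      δ ≠ splitDiscriminantClass 2 d → weilSign d δ = 1 → WeilClassesComponent 2 d δ)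
    (A : AbelianVariety ℂ) (hA : A.dim ≤ 5) : HodgeConjectureFor A.dim A.X :=
  hodgeConjectureFor_abelian_dim_le_five_of_refereed_and_positive_residualSq hred hK hS landherrSplitCriterion_holds
    hM23 hR A hA

/-- **The floor from the gen-8 residual pair on the signed cells**, Landherr discharged.
[cite: MoonenZarhin1999, Thm. 0.1] [cite: vanGeemen1994HodgeAV, 5.3, 5.8–5.11] [cite: CharlesSchnell2014Notes, Conj. 11.3.1] -/
theorem hodgeConjectureFor_abelian_dim_le_five_of_refereed_connected_variational_L
    (hred : MoonenZarhin1999_hodgeClasses_abelian_dim_le_five_of_weilClassesFourfolds)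
    (hK : Koike2004_weilClasses_algebraic_hyperbolicSixfold_one)
    (hS : Schoen1998_weilClasses_algebraic_hyperbolicSixfold_three)
    (hM23 : Markman2023_weilClasses_algebraic_discOneWeilFourfold)
    (hCV : ∀ d : ℕ, 0 < d → Squarefree d → d ≠ 1 → d ≠ 3 → ∀ δ : weilNormResidueGroup d,
      δ ≠ splitDiscriminantClass 2 d → weilSign d δ = 1 →
        IsogenyConnectedWeilComponent 2 d δ ∧ WeilVariationalHodgeComponent 2 d δ)
    (A : AbelianVariety ℂ) (hA : A.dim ≤ 5) : HodgeConjectureFor A.dim A.X :=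
  hodgeConjectureFor_abelian_dim_le_five_of_refereed_connected_variational hred hK hS landherrSplitCriterion_holds
    hM23 hCV A hA

/-- **The floor from the gen-8 residual pair, uniformly in the sign**, Landherr discharged (the negative cells are
theorems, part 5). [cite: MoonenZarhin1999, Thm. 0.1] [cite: vanGeemen1994HodgeAV, Lemma 5.2 (4), 5.3, 5.8–5.11]
[cite: CharlesSchnell2014Notes, Conj. 11.3.1] -/
theorem hodgeConjectureFor_abelian_dim_le_five_of_refereed_connected_variational_L'
    (hred : MoonenZarhin1999_hodgeClasses_abelian_dim_le_five_of_weilClassesFourfolds)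
    (hK : Koike2004_weilClasses_algebraic_hyperbolicSixfold_one)
    (hS : Schoen1998_weilClasses_algebraic_hyperbolicSixfold_three)
    (hM23 : Markman2023_weilClasses_algebraic_discOneWeilFourfold)
    (hCV : ∀ d : ℕ, 0 < d → Squarefree d → d ≠ 1 → d ≠ 3 → ∀ δ : weilNormResidueGroup d,
      δ ≠ splitDiscriminantClass 2 d →
        IsogenyConnectedWeilComponent 2 d δ ∧ WeilVariationalHodgeComponent 2 d δ)
    (A : AbelianVariety ℂ) (hA : A.dim ≤ 5) : HodgeConjectureFor A.dim A.X :=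
  hodgeConjectureFor_abelian_dim_le_five_of_refereed_connected_variational' hred hK hS landherrSplitCriterion_holds
    hM23 hCV A hA

end Summit.HodgeConjecture.HodgeConjecture.Ring2.AbelianAll

end
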